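import Summits.AtomisticToContinuum.Crystallization.Theorems.HullExactificationCascadeHcpLandscapeGapStubSiteEnergyHeights

/-!
# Crux `HcpLandscapeGap` (stmt-AtomisticToContinuum-12087), line `registered` (birth) — stub SS
# `stub_slipSiteEnergy`

STUB SS of the lateral-slip cut of stub T (`Cruxes/HcpLandscapeGap/Lines/birth.lean`, lead c6):
the layer-by-layer decomposition of the FULL Lennard-Jones site energy of one point of a
LATERALLY SLIPPED layered set.  Layer `k` is the triangular lattice `ℤ u + ℤ v` of spacing
`a ∈ [47/50, 1]` (`u = triangularVec₁ a`, `v = triangularVec₂ a`), translated by an arbitrary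
IN-PLANE vector `τ k` (`(τ k) 2 = 0`) and lifted to the height `H k` (`+ layerNormal (H k)`), the
heights having every spacing in `[39a/50, 17a/20]`:

  `S = {i' u + j' v + τ k + (H k) e₃ : k, i', j' ∈ ℤ}`,  `p₀ = i u + j v + τ m + (H m) e₃`.

Claim: (1) `z ↦ V_LJ(dist p₀ z)` is summable over the other points of `S`; (2) the layer series
`k ↦ Σ'_{(i',j') ∈ ℤ²} V_LJ ‖i' u + j' v + (τ k − τ m) + (H k − H m) e₃‖` (`k ≠ m`) is summable;
(3) `Σ'_{z ∈ S, z ≠ p₀} V_LJ(dist p₀ z) = Φ₀(a) + Σ'_{k ≠ m} (that layer sum)`,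
`Φ₀ = inLayerInteraction`.

This is the verbatim analogue of stub RS (`stub_siteEnergyHeights`, the registered case
`τ k = (haggLabel s k) • barlowOffset a`) with the letter offset replaced by the free in-plane
translation.  Mechanism: in one layer distinct points differ by a nonzero lattice vector, of norm
`≥ a` (`‖p u + q v‖² = a² (p² + pq + q²)`); points of different layers differ in the third
coordinate by `|H k − H k'| ≥ 39a/50` (τ is in-plane), so distinct indices `(k, i', j')` give points
at distance `≥ min a (39a/50) > 0`: the parametrisation of `S` by `ℤ³` is a bijection and `S` is
uniformly discrete, whence (1) (`HullBulkOptimal.summable_lennardJones_site`).  Transported to `ℤ³`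
(the missing diagonal term is `V_LJ(0) = 0`) the family is summable, `Summable.tsum_prod` regroups
it by layers; the fibre over `k` is, after the in-layer translation `(i', j') ↦ (i' − i, j' − j)`,
the displayed layer sum, and for `k = m` it is the punctured in-layer sum `Φ₀(a)` (again
`V_LJ(0) = 0`).  Splitting off `k = m` (`Summable.tsum_eq_add_tsum_ite`) gives (2) and (3).  The
generic part of the bookkeeping (a point set injectively parametrised by `ℤ³`) is isolated in
`SlipSiteEnergy.summable_param` / `SlipSiteEnergy.tsum_param`.  All [folklore].
-/

noncomputable section

namespace Summit.AtomisticToContinuum.Crystallization.Theorems.HcpLandscapeGapBirth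

open Literature.MathematicalPhysics.StatisticalMechanics
open Summit.AtomisticToContinuum.Crystallization.Theorems

namespace SlipSiteEnergy

/-! ### Generic bookkeeping: a point set injectively parametrised by `ℤ³` -/

section Param

variable {G : ℤ × ℤ × ℤ → EuclideanSpace ℝ (Fin 3)} {S : Set (EuclideanSpace ℝ (Fin 3))}

/-- **Transport of summability to the parameters.**  If `G : ℤ³ → ℝ³` is injective with values in
`S` and `f` is summable over the points of `S` other than `G q₀`, then `q ↦ f (G q)` is summable on
`ℤ³` (the one extra index `q₀` is harmless). [folklore] -/
theorem summable_param (hG : Function.Injective G) (hmem : ∀ q, G q ∈ S) (q₀ : ℤ × ℤ × ℤ)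
    (f : EuclideanSpace ℝ (Fin 3) → ℝ)
    (hf : Summable fun z : ↥({z : EuclideanSpace ℝ (Fin 3) | z ∈ S ∧ z ≠ G q₀} :
      Set (EuclideanSpace ℝ (Fin 3))) => f (z : EuclideanSpace ℝ (Fin 3))) :
    Summable fun q : ℤ × ℤ × ℤ => f (G q) := by
  -- the (exactly one) index whose point is `G q₀`
  have hS : (G ⁻¹' {G q₀}).Finite := (Set.subsingleton_singleton.preimage hG).finite
  let φ : ↥(G ⁻¹' {G q₀})ᶜ →
      ↥({z : EuclideanSpace ℝ (Fin 3) | z ∈ S ∧ z ≠ G q₀} : Set (EuclideanSpace ℝ (Fin 3))) :=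
    fun c => ⟨G c.1, hmem c.1, fun hc => c.2 hc⟩
  have hφ : Function.Injective φ := by
    intro c c' hcc'
    have h1 : G c.1 = G c'.1 := congrArg Subtype.val hcc'
    exact Subtype.ext (hG h1)
  have h1 : Summable ((fun z : ↥({z : EuclideanSpace ℝ (Fin 3) | z ∈ S ∧ z ≠ G q₀} :
      Set (EuclideanSpace ℝ (Fin 3))) => f (z : EuclideanSpace ℝ (Fin 3))) ∘ φ) :=
    hf.comp_injective hφ
  have h2 : Summable ((fun q : ℤ × ℤ × ℤ => f (G q)) ∘
      ((↑) : ↥(G ⁻¹' {G q₀})ᶜ → ℤ × ℤ × ℤ)) := h1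
  exact hS.summable_compl_iff.1 h2

/-- **The punctured sum over the point set is the full `ℤ³`-parametrised sum.**  If `G : ℤ³ → ℝ³`
is a bijection onto `S` and `f (G q₀) = 0`, then `Σ'_{z ∈ S, z ≠ G q₀} f z = Σ'_{q ∈ ℤ³} f (G q)`.
[folklore] -/
theorem tsum_param (hG : Function.Injective G) (hmem : ∀ q, G q ∈ S)
    (hsurj : ∀ z ∈ S, ∃ q, G q = z) (q₀ : ℤ × ℤ × ℤ) (f : EuclideanSpace ℝ (Fin 3) → ℝ)
    (h0 : f (G q₀) = 0) :
    ∑' z : ↥({z : EuclideanSpace ℝ (Fin 3) | z ∈ S ∧ z ≠ G q₀} : Set (EuclideanSpace ℝ (Fin 3))),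
      f (z : EuclideanSpace ℝ (Fin 3)) = ∑' q : ℤ × ℤ × ℤ, f (G q) := by
  let φ : ↥({q₀}ᶜ : Set (ℤ × ℤ × ℤ)) →
      ↥({z : EuclideanSpace ℝ (Fin 3) | z ∈ S ∧ z ≠ G q₀} : Set (EuclideanSpace ℝ (Fin 3))) :=
    fun c => ⟨G c.1, hmem c.1, fun hc => c.2 (hG hc)⟩
  have hφ : Function.Injective φ := by
    intro c c' hcc'
    have h1 : G c.1 = G c'.1 := congrArg Subtype.val hcc'
    exact Subtype.ext (hG h1)
  -- `φ` is onto
  have hrange : Function.support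
      (fun z : ↥({z : EuclideanSpace ℝ (Fin 3) | z ∈ S ∧ z ≠ G q₀} :
        Set (EuclideanSpace ℝ (Fin 3))) => f (z : EuclideanSpace ℝ (Fin 3))) ⊆ Set.range φ := by
    intro z _
    obtain ⟨q, hq⟩ := hsurj z.1 z.2.1
    have hne : q ∈ ({q₀}ᶜ : Set (ℤ × ℤ × ℤ)) := by
      intro hq0
      rw [Set.mem_singleton_iff.1 hq0] at hq
      exact z.2.2 hq.symm
    exact ⟨⟨q, hne⟩, Subtype.ext hq⟩
  rw [← hφ.tsum_eq hrange]
  have hsupp : Function.support (fun q : ℤ × ℤ × ℤ => f (G q)) ⊆ ({q₀}ᶜ : Set (ℤ × ℤ × ℤ)) := by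
    intro q hq
    rw [Function.mem_support] at hq
    simp only [Set.mem_compl_iff, Set.mem_singleton_iff]
    rintro rfl
    exact hq h0
  exact tsum_subtype_eq_of_support_subset hsupp

end Param

/-! ### Geometry of the slipped layered set -/

/-- `layerNormal` is additive: `(h − h') e₃ = h e₃ − h' e₃`. [folklore] -/
theorem layerNormal_sub (h h' : ℝ) : layerNormal (h - h') = layerNormal h - layerNormal h' := by
  ext l
  fin_cases l <;> simp [layerNormal]

/-- The third coordinate of `u = triangularVec₁ a` vanishes. [folklore] -/
theorem triangularVec₁_apply_two (a : ℝ) : triangularVec₁ a 2 = 0 := by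
  simp [triangularVec₁]

/-- The third coordinate of `v = triangularVec₂ a` vanishes. [folklore] -/
theorem triangularVec₂_apply_two (a : ℝ) : triangularVec₂ a 2 = 0 := by
  simp [triangularVec₂]

variable {a : ℝ} {H : ℤ → ℝ} {τ : ℤ → EuclideanSpace ℝ (Fin 3)}

/-- **A slipped layer lies in the plane `x₃ = H k`** when the translation `τ k` is in-plane.
[folklore] -/
theorem slipPos_apply_two (hτ : ∀ k : ℤ, τ k 2 = 0) (k i j : ℤ) :
    ((i : ℝ) • triangularVec₁ a + (j : ℝ) • triangularVec₂ a + τ k + layerNormal (H k)) 2 =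
      H k := by
  rw [PiLp.add_apply, PiLp.add_apply, PiLp.add_apply, PiLp.smul_apply, PiLp.smul_apply,
    triangularVec₁_apply_two, triangularVec₂_apply_two, hτ k]
  simp [layerNormal]

/-- Differences of points of the slipped set: a lattice vector, plus the relative slip, plus the
height difference. [folklore] -/
theorem slipPos_sub (a : ℝ) (H : ℤ → ℝ) (τ : ℤ → EuclideanSpace ℝ (Fin 3)) (m i j k i' j' : ℤ) :
    ((i' : ℝ) • triangularVec₁ a + (j' : ℝ) • triangularVec₂ a + τ k + layerNormal (H k)) -
      ((i : ℝ) • triangularVec₁ a + (j : ℝ) • triangularVec₂ a + τ m + layerNormal (H m)) =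
      ((i' - i : ℤ) : ℝ) • triangularVec₁ a + ((j' - j : ℤ) : ℝ) • triangularVec₂ a + (τ k - τ m) +
        layerNormal (H k - H m) := by
  rw [layerNormal_sub]
  push_cast
  module

/-- **In-layer separation**: a nonzero vector of the triangular lattice of spacing `a ≥ 0` has norm
`≥ a` (`‖p u + q v‖² = a² (p² + p q + q²)` and the form is `≥ 1` off the origin). [folklore] -/
theorem le_norm_inLayer (ha : 0 ≤ a) {p q : ℤ} (hpq : (p, q) ≠ 0) :
    a ≤ ‖(p : ℝ) • triangularVec₁ a + (q : ℝ) • triangularVec₂ a‖ := by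
  rw [← LayeredHull.cake_layerVec_height_zero]
  have hsq := LayeredHull.cake_norm_layerVec_inLayer_sq a p q
  have hQ : (1 : ℝ) ≤ ((p ^ 2 + p * q + q ^ 2 : ℤ) : ℝ) := by
    exact_mod_cast one_le_sq_add_mul_add_sq hpq
  push_cast at hQ
  have h2 : a ^ 2 ≤ ‖layerVec a 0 0 1 p q‖ ^ 2 := by
    rw [hsq]
    nlinarith [sq_nonneg a]
  exact (pow_le_pow_iff_left₀ ha (norm_nonneg _) two_ne_zero).1 h2

/-- **Interlayer separation**: for heights with gaps `≥ g ≥ 0`, distinct layers are `≥ g` apart in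
height. [folklore] -/
theorem le_abs_height_sub {g : ℝ} (hg : 0 ≤ g) (hgap : ∀ k : ℤ, g ≤ H (k + 1) - H k) {k k' : ℤ}
    (hk : k ≠ k') : g ≤ |H k - H k'| := by
  rcases lt_or_gt_of_ne hk with hlt | hlt
  · have h1 := sub_le_of_gap_le H hgap hlt.le
    have h2 : (1 : ℝ) ≤ (k' : ℝ) - k := by
      have : k + 1 ≤ k' := hlt
      have : ((k : ℝ)) + 1 ≤ k' := by exact_mod_cast this
      linarith
    rw [abs_sub_comm]
    calc g ≤ ((k' : ℝ) - k) * g := le_mul_of_one_le_left hg h2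
      _ ≤ H k' - H k := h1
      _ ≤ |H k' - H k| := le_abs_self _
  · have h1 := sub_le_of_gap_le H hgap hlt.le
    have h2 : (1 : ℝ) ≤ (k : ℝ) - k' := by
      have : k' + 1 ≤ k := hlt
      have : ((k' : ℝ)) + 1 ≤ k := by exact_mod_cast this
      linarith
    calc g ≤ ((k : ℝ) - k') * g := le_mul_of_one_le_left hg h2
      _ ≤ H k - H k' := h1
      _ ≤ |H k - H k'| := le_abs_self _

/-- **Uniform discreteness of the slipped set**: for `a ≥ 0`, gaps `≥ g ≥ 0` and in-plane slips,
distinct indices `(k, i, j) ≠ (k', i', j')` give points at distance `≥ min a g`. [folklore] -/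
theorem le_dist_slipPos (ha : 0 ≤ a) {g : ℝ} (hg : 0 ≤ g) (hgap : ∀ k : ℤ, g ≤ H (k + 1) - H k)
    (hτ : ∀ k : ℤ, τ k 2 = 0) {k i j k' i' j' : ℤ} (hne : (k, i, j) ≠ (k', i', j')) :
    min a g ≤
      dist ((i : ℝ) • triangularVec₁ a + (j : ℝ) • triangularVec₂ a + τ k + layerNormal (H k))
      ((i' : ℝ) • triangularVec₁ a + (j' : ℝ) • triangularVec₂ a + τ k' + layerNormal (H k')) := by
  by_cases hk : k = k'
  · subst hk
    have hij : ((i' - i : ℤ), (j' - j : ℤ)) ≠ (0 : ℤ × ℤ) := by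
      intro h0
      apply hne
      simp only [Prod.mk_eq_zero, sub_eq_zero] at h0
      rw [h0.1, h0.2]
    refine (min_le_left _ _).trans ?_
    rw [dist_comm, dist_eq_norm, slipPos_sub, sub_self, sub_self, add_zero,
      LayeredHull.cake_layerNormal_zero, add_zero]
    exact le_norm_inLayer ha hij
  · refine (min_le_right _ _).trans (le_trans ?_ (PiLp.dist_apply_le _ _ 2))
    rw [slipPos_apply_two hτ, slipPos_apply_two hτ, Real.dist_eq]
    exact le_abs_height_sub hg hgap hk

/-- For `a > 0`, gaps `≥ g > 0` and in-plane slips, the parametrisation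
`(k, i, j) ↦ i u + j v + τ k + (H k) e₃` of the slipped set by `ℤ³` is injective. [folklore] -/
theorem slipPos_injective (ha : 0 < a) {g : ℝ} (hg : 0 < g)
    (hgap : ∀ k : ℤ, g ≤ H (k + 1) - H k) (hτ : ∀ k : ℤ, τ k 2 = 0) :
    Function.Injective fun q : ℤ × ℤ × ℤ =>
      (q.2.1 : ℝ) • triangularVec₁ a + (q.2.2 : ℝ) • triangularVec₂ a + τ q.1 +
        layerNormal (H q.1) := by
  intro q q' hqq'
  by_contra hne
  have hle := le_dist_slipPos ha.le hg.le hgap hτ (k := q.1) (i := q.2.1) (j := q.2.2)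
    (k' := q'.1) (i' := q'.2.1) (j' := q'.2.2) hne
  have h0 : (q.2.1 : ℝ) • triangularVec₁ a + (q.2.2 : ℝ) • triangularVec₂ a + τ q.1 +
      layerNormal (H q.1) =
      (q'.2.1 : ℝ) • triangularVec₁ a + (q'.2.2 : ℝ) • triangularVec₂ a + τ q'.1 +
        layerNormal (H q'.1) := hqq'
  rw [h0, dist_self] at hle
  exact absurd hle (not_le.2 (lt_min ha hg))

/-- The slipped set with `a ≥ 0`, gaps `≥ g ≥ 0` and in-plane slips is `min a g`-separated, in the
form consumed by `HullBulkOptimal.summable_lennardJones_site`. [folklore] -/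
theorem separated_slip (ha : 0 ≤ a) {g : ℝ} (hg : 0 ≤ g) (hgap : ∀ k : ℤ, g ≤ H (k + 1) - H k)
    (hτ : ∀ k : ℤ, τ k 2 = 0) :
    ∀ x ∈ {p : EuclideanSpace ℝ (Fin 3) | ∃ k i' j' : ℤ, p = (i' : ℝ) • triangularVec₁ a +
        (j' : ℝ) • triangularVec₂ a + τ k + layerNormal (H k)},
      ∀ y ∈ {p : EuclideanSpace ℝ (Fin 3) | ∃ k i' j' : ℤ, p = (i' : ℝ) • triangularVec₁ a +
        (j' : ℝ) • triangularVec₂ a + τ k + layerNormal (H k)}, x ≠ y → min a g ≤ dist x y := by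
  rintro x ⟨k, i, j, rfl⟩ y ⟨k', i', j', rfl⟩ hxy
  refine le_dist_slipPos ha hg hgap hτ ?_
  rintro heq
  simp only [Prod.mk.injEq] at heq
  obtain ⟨rfl, rfl, rfl⟩ := heq
  exact hxy rfl

/-! ### Layer sums -/

/-- **The interaction of `p₀ = i u + j v + τ m + (H m) e₃` with the whole layer `k`** is the
lattice sum `Σ'_{(i',j')} V ‖i' u + j' v + (τ k − τ m) + (H k − H m) e₃‖` (in-layer translation
`(i', j') ↦ (i' − i, j' − j)`; any pair potential `V`). [folklore] -/
theorem tsum_slipLayer (V : ℝ → ℝ) (a : ℝ) (H : ℤ → ℝ) (τ : ℤ → EuclideanSpace ℝ (Fin 3))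
    (m i j k : ℤ) :
    ∑' ij : ℤ × ℤ, V (dist ((i : ℝ) • triangularVec₁ a + (j : ℝ) • triangularVec₂ a + τ m +
        layerNormal (H m)) ((ij.1 : ℝ) • triangularVec₁ a + (ij.2 : ℝ) • triangularVec₂ a + τ k +
        layerNormal (H k))) =
      ∑' ij : ℤ × ℤ, V ‖(ij.1 : ℝ) • triangularVec₁ a + (ij.2 : ℝ) • triangularVec₂ a +
        (τ k - τ m) + layerNormal (H k - H m)‖ := by
  rw [← (Equiv.addRight ((i, j) : ℤ × ℤ)).tsum_eq fun ij : ℤ × ℤ =>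
    V (dist ((i : ℝ) • triangularVec₁ a + (j : ℝ) • triangularVec₂ a + τ m + layerNormal (H m))
      ((ij.1 : ℝ) • triangularVec₁ a + (ij.2 : ℝ) • triangularVec₂ a + τ k + layerNormal (H k)))]
  refine tsum_congr fun ij => ?_
  simp only [Equiv.coe_addRight, Prod.fst_add, Prod.snd_add]
  rw [dist_comm, dist_eq_norm, slipPos_sub, add_sub_cancel_right, add_sub_cancel_right]

/-- **The layer `k = m` seen from its own point** contributes the punctured in-layer sum
`Φ₀(a) = inLayerInteraction V_LJ a` (the relative slip and height vanish; the diagonal term is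
`V_LJ(0) = 0`). [folklore] -/
theorem tsum_slipLayer_self (a : ℝ) (H : ℤ → ℝ) (τ : ℤ → EuclideanSpace ℝ (Fin 3)) (m : ℤ) :
    ∑' ij : ℤ × ℤ, lennardJones ‖(ij.1 : ℝ) • triangularVec₁ a + (ij.2 : ℝ) • triangularVec₂ a +
        (τ m - τ m) + layerNormal (H m - H m)‖ = inLayerInteraction lennardJones a := by
  unfold inLayerInteraction
  refine tsum_congr fun ij => ?_
  rw [sub_self, sub_self, LayeredHull.cake_layerNormal_zero, add_zero, add_zero]
  split_ifs with h0
  · rw [h0]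
    simp [lennardJones_zero]
  · rfl

end SlipSiteEnergy

open SlipSiteEnergy in
/-- **Stub SS — site energy of a point of a laterally slipped layered set, layer by layer.**  For
`a ∈ [47/50, 1]`, heights `H` with spacings in `[39a/50, 17a/20]`, in-plane slips `τ`
(`(τ k) 2 = 0`) and the point `p₀ = i u + j v + τ m + (H m) e₃` of
`S = {i' u + j' v + τ k + (H k) e₃}`: the family `z ↦ V_LJ(dist p₀ z)` over the other points of `S`
is summable, the layer series is summable, and
`Σ'_{z ∈ S, z ≠ p₀} V_LJ(dist p₀ z) = inLayerInteraction V_LJ a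
  + Σ'_{k ≠ m} Σ'_{(i',j')} V_LJ ‖i' u + j' v + (τ k − τ m) + (H k − H m) e₃‖`
(regroup the absolutely summable family over `(k, i', j')` by layers; the hypotheses on `a` and the
spacing band enter only through `a > 0` and gaps `≥ 39a/50 > 0`). [folklore] -/
theorem stub_slipSiteEnergy : ∀ (a : ℝ), 47 / 50 ≤ a → a ≤ 1 → ∀ H : ℤ → ℝ, (∀ k : ℤ, 39 / 50 * a ≤ H (k + 1) - H k ∧ H (k + 1) - H k ≤ 17 / 20 * a) → ∀ τ : ℤ → EuclideanSpace ℝ (Fin 3), (∀ k : ℤ, τ k 2 = 0) → ∀ m i j : ℤ, Summable (fun z : ↥{z : EuclideanSpace ℝ (Fin 3) | z ∈ {p : EuclideanSpace ℝ (Fin 3) | ∃ k i' j' : ℤ, p = (i' : ℝ) • Literature.MathematicalPhysics.StatisticalMechanics.triangularVec₁ a + (j' : ℝ) • Literature.MathematicalPhysics.StatisticalMechanics.triangularVec₂ a + τ k + Literature.MathematicalPhysics.StatisticalMechanics.layerNormal (H k)} ∧ z ≠ (i : ℝ) • Literature.MathematicalPhysics.StatisticalMechanics.triangularVec₁ a +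 (j : ℝ) • Literature.MathematicalPhysics.StatisticalMechanics.triangularVec₂ a + τ m + Literature.MathematicalPhysics.StatisticalMechanics.layerNormal (H m)} => Literature.MathematicalPhysics.StatisticalMechanics.lennardJones (dist ((i : ℝ) • Literature.MathematicalPhysics.StatisticalMechanics.triangularVec₁ a + (j : ℝ) • Literature.MathematicalPhysics.StatisticalMechanics.triangularVec₂ a + τ m + Literature.MathematicalPhysics.StatisticalMechanics.layerNormal (H m)) (z : EuclideanSpace ℝ (Fin 3)))) ∧ Summable (fun k : ℤ => if k = m then (0 : ℝ) else ∑' ij : ℤ × ℤ, Literature.MathematicalPhysics.StatisticalMechanics.lennardJones ‖(ij.1 : ℝ) • Literature.MathematicalPhysics.StatisticalMechanics.triangularVec₁ a + (ij.2 : ℝ) • Literature.MathematicalPhysics.StatisticalMechanics.triangularVec₂ a + (τ k - τ m) + Literature.MathematicalPhysics.StatisticalMechanics.layerNormal (H k - H m)‖) ∧ (∑' z : ↥{z : EuclideanSpace ℝ (Fin 3) | z ∈ {p : EuclideanSpace ℝ (Fin 3) | ∃ k i' j' : ℤ, p = (i' : ℝ) • Literature.MathematicalPhysics.StatisticalMechanics.triangularVec₁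 a + (j' : ℝ) • Literature.MathematicalPhysics.StatisticalMechanics.triangularVec₂ a + τ k + Literature.MathematicalPhysics.StatisticalMechanics.layerNormal (H k)} ∧ z ≠ (i : ℝ) • Literature.MathematicalPhysics.StatisticalMechanics.triangularVec₁ a + (j : ℝ) • Literature.MathematicalPhysics.StatisticalMechanics.triangularVec₂ a + τ m + Literature.MathematicalPhysics.StatisticalMechanics.layerNormal (H m)}, Literature.MathematicalPhysics.StatisticalMechanics.lennardJones (dist ((i : ℝ) • Literature.MathematicalPhysics.StatisticalMechanics.triangularVec₁ a + (j : ℝ) • Literature.MathematicalPhysics.StatisticalMechanics.triangularVec₂ a + τ m + Literature.MathematicalPhysics.StatisticalMechanics.layerNormal (H m)) (z : EuclideanSpace ℝ (Fin 3)))) = Literature.MathematicalPhysics.StatisticalMechanics.inLayerInteraction Literature.MathematicalPhysics.StatisticalMechanics.lennardJones a + ∑' k : ℤ, (if k = m then (0 : ℝ) else ∑' ij : ℤ × ℤ, Literature.MathematicalPhysics.StatisticalMechanics.lennardJones ‖(ij.1 : ℝ) • Literature.MathematicalPhysics.StatisticalMechanics.triangularVec₁ a + (ij.2 : ℝ) •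 Literature.MathematicalPhysics.StatisticalMechanics.triangularVec₂ a + (τ k - τ m) + Literature.MathematicalPhysics.StatisticalMechanics.layerNormal (H k - H m)‖) := by
  intro a ha _ H hband τ hτ m i j
  have ha0 : 0 < a := by linarith
  have hg : 0 < 39 / 50 * a := by positivity
  have hgap : ∀ k : ℤ, 39 / 50 * a ≤ H (k + 1) - H k := fun k => (hband k).1
  -- the injective parametrisation of `S` by `ℤ³`
  have hG := slipPos_injective ha0 hg hgap hτ
  have hmem : ∀ q : ℤ × ℤ × ℤ,
      (q.2.1 : ℝ) • triangularVec₁ a + (q.2.2 : ℝ) • triangularVec₂ a + τ q.1 +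
          layerNormal (H q.1) ∈
        {p : EuclideanSpace ℝ (Fin 3) | ∃ k i' j' : ℤ, p = (i' : ℝ) • triangularVec₁ a +
          (j' : ℝ) • triangularVec₂ a + τ k + layerNormal (H k)} :=
    fun q => ⟨q.1, q.2.1, q.2.2, rfl⟩
  have hsurj : ∀ z ∈ {p : EuclideanSpace ℝ (Fin 3) | ∃ k i' j' : ℤ, p =
      (i' : ℝ) • triangularVec₁ a + (j' : ℝ) • triangularVec₂ a + τ k + layerNormal (H k)},
      ∃ q : ℤ × ℤ × ℤ, (q.2.1 : ℝ) • triangularVec₁ a + (q.2.2 : ℝ) • triangularVec₂ a + τ q.1 +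
        layerNormal (H q.1) = z := by
    rintro z ⟨k, i', j', rfl⟩
    exact ⟨(k, i', j'), rfl⟩
  -- (1) summability over the point set: `S` is `min a (39a/50)`-separated
  have h1 : Summable (fun z : ↥{z : EuclideanSpace ℝ (Fin 3) | z ∈ {p : EuclideanSpace ℝ (Fin 3) |
      ∃ k i' j' : ℤ, p = (i' : ℝ) • triangularVec₁ a + (j' : ℝ) • triangularVec₂ a + τ k +
        layerNormal (H k)} ∧ z ≠ (i : ℝ) • triangularVec₁ a + (j : ℝ) • triangularVec₂ a + τ m +
        layerNormal (H m)} => lennardJones (dist ((i : ℝ) • triangularVec₁ a +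
          (j : ℝ) • triangularVec₂ a + τ m + layerNormal (H m)) (z : EuclideanSpace ℝ (Fin 3)))) :=
    HullBulkOptimal.summable_lennardJones_site (lt_min ha0 hg) (separated_slip ha0.le hg.le hgap hτ)
      ⟨m, i, j, rfl⟩
  -- the `ℤ³`-parametrised family and its layer sums
  have hF : Summable fun q : ℤ × ℤ × ℤ => lennardJones (dist ((i : ℝ) • triangularVec₁ a +
      (j : ℝ) • triangularVec₂ a + τ m + layerNormal (H m)) ((q.2.1 : ℝ) • triangularVec₁ a +
      (q.2.2 : ℝ) • triangularVec₂ a + τ q.1 + layerNormal (H q.1))) :=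
    summable_param hG hmem (m, i, j) (fun z => lennardJones (dist ((i : ℝ) • triangularVec₁ a +
      (j : ℝ) • triangularVec₂ a + τ m + layerNormal (H m)) z)) h1
  have hL : Summable fun k : ℤ => ∑' ij : ℤ × ℤ, lennardJones ‖(ij.1 : ℝ) • triangularVec₁ a +
      (ij.2 : ℝ) • triangularVec₂ a + (τ k - τ m) + layerNormal (H k - H m)‖ :=
    hF.prod.congr fun k => tsum_slipLayer lennardJones a H τ m i j k
  have e1 : ∑' q : ℤ × ℤ × ℤ, lennardJones (dist ((i : ℝ) • triangularVec₁ a +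
      (j : ℝ) • triangularVec₂ a + τ m + layerNormal (H m)) ((q.2.1 : ℝ) • triangularVec₁ a +
      (q.2.2 : ℝ) • triangularVec₂ a + τ q.1 + layerNormal (H q.1))) =
      ∑' k : ℤ, ∑' ij : ℤ × ℤ, lennardJones ‖(ij.1 : ℝ) • triangularVec₁ a +
        (ij.2 : ℝ) • triangularVec₂ a + (τ k - τ m) + layerNormal (H k - H m)‖ :=
    hF.tsum_prod.trans (tsum_congr fun k => tsum_slipLayer lennardJones a H τ m i j k)
  -- the punctured point-set sum is the full `ℤ³` sum (the diagonal term is `V_LJ(0) = 0`)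
  have e0 : ∑' z : ↥{z : EuclideanSpace ℝ (Fin 3) | z ∈ {p : EuclideanSpace ℝ (Fin 3) |
      ∃ k i' j' : ℤ, p = (i' : ℝ) • triangularVec₁ a + (j' : ℝ) • triangularVec₂ a + τ k +
        layerNormal (H k)} ∧ z ≠ (i : ℝ) • triangularVec₁ a + (j : ℝ) • triangularVec₂ a + τ m +
        layerNormal (H m)}, lennardJones (dist ((i : ℝ) • triangularVec₁ a +
          (j : ℝ) • triangularVec₂ a + τ m + layerNormal (H m)) (z : EuclideanSpace ℝ (Fin 3))) =
      ∑' q : ℤ × ℤ × ℤ, lennardJones (dist ((i : ℝ) • triangularVec₁ a +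
        (j : ℝ) • triangularVec₂ a + τ m + layerNormal (H m)) ((q.2.1 : ℝ) • triangularVec₁ a +
        (q.2.2 : ℝ) • triangularVec₂ a + τ q.1 + layerNormal (H q.1))) :=
    tsum_param hG hmem hsurj (m, i, j) (fun z => lennardJones (dist ((i : ℝ) • triangularVec₁ a +
      (j : ℝ) • triangularVec₂ a + τ m + layerNormal (H m)) z)) (by
        show lennardJones (dist _ _) = 0
        rw [dist_self, lennardJones_zero])
  -- split off the layer `k = m`
  have e2 := hL.tsum_eq_add_tsum_ite m
  refine ⟨h1, (hasSum_ite_sub_hasSum hL.hasSum m).summable, ?_⟩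
  rw [e0, e1, e2, tsum_slipLayer_self]

end Summit.AtomisticToContinuum.Crystallization.Theorems.HcpLandscapeGapBirth

end
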